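import Mathlib
import Summits.Ventures.HodgeRepro2.T5DegreeOneCompletion

/-!
# T5DegreeOneIntegers — the integers of the completion at a degree-one prime are `ℤ_[p]`

Tier-5 kernel support (seat p7), file (5) of the chain behind route/T5-LEAN-p7.md §22 (fourth
addendum) and §33 / §34: the isomorphism `adicCompletionRingEquiv : w.adicCompletion K ≃+* ℚ_[p]`
of `T5DegreeOneCompletion` carries the valuation ring of the completion onto `ℤ_[p]`:
`‖adicCompletionRingEquiv x‖ ≤ 1 ↔ Valued.v x ≤ 1` (`adicCompletionRingEquiv_norm_le_one_iff`;
both sides are clopen conditions agreeing on the dense subfield `K`, the template of Mathlib's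
`Padic.withValUniformEquiv_norm_le_one_iff`), hence
* `integersRingEquiv : w.adicCompletionIntegers K ≃+* ℤ_[p]` (Mathlib's `RingEquiv.restrict`),
  restricting to `toPadicInt` on `R` (`integersRingEquiv_algebraMap`).

Setting: `R` a Dedekind domain with fraction field `K`, `w : HeightOneSpectrum R`, `p` a rational
prime with `(p : R) ∈ w.asIdeal`, `(p : R) ∉ w.asIdeal ^ 2` (`e = 1`) and `ℤ → R ⧸ w.asIdeal`
surjective (`f = 1`). Mathlib only beyond the chain.
-/

namespace Summit.Ventures.HodgeRepro2.T5DegreeOneIntegers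

open Ideal IsDedekindDomain WithZero UniformSpace
open Summit.Ventures.HodgeRepro2.T5DegreeOneQuotient Summit.Ventures.HodgeRepro2.T5DegreeOnePadicInt
  Summit.Ventures.HodgeRepro2.T5DegreeOnePadic Summit.Ventures.HodgeRepro2.T5DegreeOneCompletion

variable {R : Type*} [CommRing R] [IsDedekindDomain R] {K : Type*} [Field K] [Algebra R K]
  [IsFractionRing R K] (w : HeightOneSpectrum R) {p : ℕ} [hp : Fact p.Prime]
  (hpP : (p : R) ∈ w.asIdeal) (hpP2 : (p : R) ∉ w.asIdeal ^ 2)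
  (hsurj : ∀ x : R, ∃ a : ℤ, x - a ∈ w.asIdeal)
include hpP hpP2 hsurj

/-- On the completion, `‖withValRingEquiv x‖ ≤ 1 ↔ Valued.v x ≤ 1`: the unit ball of `ℚ_[p]`
corresponds to the unit ball of `(w.valuation K).Completion` (both clopen; they agree on the dense
image of `K` by `norm_toPadic_le_one_iff`). -/
theorem withValRingEquiv_norm_le_one_iff (x : (w.valuation K).Completion) :
    ‖withValRingEquiv w hpP hpP2 hsurj (K := K) x‖ ≤ 1 ↔ Valued.v x ≤ 1 := by
  induction x using UniformSpace.Completion.induction_on with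
  | hp =>
    rw [Set.ext fun _ ↦ Iff.comm]
    simp_rw [← Valuation.restrict_le_one_iff Valued.v]
    apply (withValUniformEquiv w hpP hpP2 hsurj (K := K)).toHomeomorph.isClosed_setOf_iff
      (q := fun x ↦ ‖x‖ ≤ 1) (Valued.isClopen_closedBall _ one_ne_zero)
    simpa [Metric.closedBall] using IsUltrametricDist.isClopen_closedBall (0 : ℚ_[p]) one_ne_zero
  | ih a =>
    rw [Valued.valuedCompletion_apply, withValRingEquiv_coe, ← WithVal.val_apply_equiv]
    exact norm_toPadic_le_one_iff w hpP hpP2 hsurj _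

/-- On Mathlib's `w.adicCompletion K`: `‖adicCompletionRingEquiv x‖ ≤ 1 ↔ Valued.v x ≤ 1`. -/
theorem adicCompletionRingEquiv_norm_le_one_iff (x : w.adicCompletion K) :
    ‖adicCompletionRingEquiv w hpP hpP2 hsurj (K := K) x‖ ≤ 1 ↔ Valued.v x ≤ 1 := by
  rw [adicCompletionRingEquiv, RingEquiv.trans_apply, HeightOneSpectrum.adicCompletion.equiv_apply,
    withValRingEquiv_norm_le_one_iff, HeightOneSpectrum.adicCompletion.valued_toCompletion]

/-- `x` is a `w`-adic integer of the completion iff `adicCompletionRingEquiv x` is a `p`-adic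
integer. -/
theorem mem_adicCompletionIntegers_iff (x : w.adicCompletion K) :
    x ∈ w.adicCompletionIntegers K ↔
      adicCompletionRingEquiv w hpP hpP2 hsurj (K := K) x ∈ PadicInt.subring p := by
  rw [HeightOneSpectrum.mem_adicCompletionIntegers, PadicInt.mem_subring_iff,
    adicCompletionRingEquiv_norm_le_one_iff]

/-- THE INTEGERS OF THE COMPLETION ARE `ℤ_[p]`: `w.adicCompletionIntegers K ≃+* ℤ_[p]` at a
degree-one prime (the restriction of `adicCompletionRingEquiv`). -/
noncomputable def integersRingEquiv : w.adicCompletionIntegers K ≃+* ℤ_[p] :=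
  (adicCompletionRingEquiv w hpP hpP2 hsurj (K := K)).restrict (w.adicCompletionIntegers K)
    (PadicInt.subring p) (mem_adicCompletionIntegers_iff w hpP hpP2 hsurj)

/-- `integersRingEquiv` is the restriction of `adicCompletionRingEquiv`. -/
theorem coe_integersRingEquiv (x : w.adicCompletionIntegers K) :
    (integersRingEquiv w hpP hpP2 hsurj (K := K) x : ℚ_[p]) =
      adicCompletionRingEquiv w hpP hpP2 hsurj (K := K) (x : w.adicCompletion K) := rfl

/-- `integersRingEquiv` restricts to `toPadicInt` on `R`. -/
theorem integersRingEquiv_algebraMap (r : R) :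
    integersRingEquiv w hpP hpP2 hsurj (K := K) (algebraMap R (w.adicCompletionIntegers K) r) =
      toPadicInt w.ne_bot hpP hpP2 hsurj r := by
  apply Subtype.ext
  rw [coe_integersRingEquiv]
  have h : ((algebraMap R (w.adicCompletionIntegers K) r : w.adicCompletionIntegers K) :
      w.adicCompletion K) = ((algebraMap R K r : K) : w.adicCompletion K) := rfl
  rw [h, adicCompletionRingEquiv_coe, toPadic_algebraMap]

/-- `integersRingEquiv` is continuous (the restriction of a homeomorphism). -/
theorem continuous_integersRingEquiv :
    Continuous (integersRingEquiv w hpP hpP2 hsurj (K := K)) := by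
  refine Continuous.subtype_mk ?_ _
  exact (continuous_adicCompletionRingEquiv w hpP hpP2 hsurj (K := K)).comp continuous_subtype_val

end Summit.Ventures.HodgeRepro2.T5DegreeOneIntegers
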